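import Summits.MatrixMultiplication.MatrixMultiplication.Theorems.ObstructionDescentUniversalOccurrenceTwoRectangleOddThreeTableaux

set_option linter.dupNamespace false
set_option autoImplicit false

/-!
# Universal occurrence — two rectangles and the type `(2N-5,3,1,1)`, part C: domino bookkeeping (decomp-mm · lens 3 · gen 44)

Route `route-MatrixMultiplication-ObstructionDescent` (sub-problem `MatrixMultiplication`, `ω(ℂ) = 2`); SUPPORT for the crux
`NoOccurrenceObstruction` (`P_O`, item `stmt-MatrixMultiplication-29040`); an input of the second four-odd family
`((2^N),(2^N),(2N-5,3,1,1)) ∈ S(⟨m⟩)`, `m ≥ N + 2` (part E, `…TwoRectangleOddThree`).  No `def`, no `sorry`.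

In the lifted design `D'(N)` (first leg `φ = (0,…,N-1 | 0,1)`, row letter `γ(1) = γ(2) = 1, γ(N) = 2, γ(N+1) = 3, γ = 0`
otherwise, blocks `e = (q mod 2, q div 2)`), a non-zero term has a block-bijective first-leg word `x = φ ∘ ι` and a third-leg
word `w = γ ∘ ι` supported on the tableau (zero on the arm `q ≥ 8`, `< 2` on the dominoes `4..7`).  Block `0` consists of the
cells `0, 2` (column), `4, 6` (dominoes) and even arm cells; it carries the `x`-letters `1` and `2` exactly once each, never on
the arm, and on a domino only as `ι = 1, 2` (row letter `1`).  Hence the DOMINO SUM `w(4) + w(6)` is determined by the two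
column letters `n₀ = ι(0), n₂ = ι(2)` of block `0`:  `w(4) + w(6) + [2 ∈ {n₀,n₂}] + [{n₀,n₂} ∩ {1,N+1} ≠ ∅] = 2`
(`oddThree_domino_sum`) — the bookkeeping identity `hd` consumed by the local sign rule of part B.

[cite: BurgisserIkenmeyer2011, Thm. 4.4] [cite: BurgisserIkenmeyer2017, §5, Thm. 5.9 (proof of (2)), eq. (3.4)]
-/

noncomputable section

namespace Summit.MatrixMultiplication.MatrixMultiplication.Theorems.ObstructionCalculus

open Literature.Computability.AlgebraicComplexity
open Literature.NumberTheory.DiophantineGeometry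

set_option maxHeartbeats 400000 in
/-- **Domino sum of block `0`.**  For a block-bijective first-leg word `x = φ ∘ ι` and a third-leg word `w = γ ∘ ι` that
vanishes on the arm and is `< 2` on the dominoes, `w(4) + w(6) + [2 ∈ {ι 0, ι 2}] + [{ι 0, ι 2} ∩ {1, N+1} ≠ ∅] = 2`. [this node] -/
theorem oddThree_domino_sum {N : ℕ} (hN : 4 ≤ N) (e : Fin (N * 2) ≃ Fin 2 × Fin N)
    (hesymm : ∀ (a : Fin 2) (j : Fin N), ((e.symm (a, j) : Fin (N * 2)) : ℕ) = (a : ℕ) + 2 * (j : ℕ))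
    (ι : Fin (N * 2) → Fin (N + 2)) (x w : Word N (N * 2))
    (hxv : ∀ q, ((x q : Fin N) : ℕ) =
      if ((ι q : Fin (N + 2)) : ℕ) < N then ((ι q : Fin (N + 2)) : ℕ) else ((ι q : Fin (N + 2)) : ℕ) - N)
    (hwv : ∀ q, ((w q : Fin N) : ℕ) =
      if ((ι q : Fin (N + 2)) : ℕ) = 1 then 1 else if ((ι q : Fin (N + 2)) : ℕ) = 2 then 1
        else if ((ι q : Fin (N + 2)) : ℕ) = N then 2 else if ((ι q : Fin (N + 2)) : ℕ) = N + 1 then 3 else 0)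
    (hbx0 : Function.Bijective (fun j => x (e.symm (0, j))))
    (harm : ∀ q : Fin (N * 2), 8 ≤ (q : ℕ) → ((w q : Fin N) : ℕ) = 0)
    (hdom : ∀ q : Fin (N * 2), 4 ≤ (q : ℕ) → (q : ℕ) < 8 → ((w q : Fin N) : ℕ) < 2)
    {p0 p2 p4 p6 : Fin (N * 2)} (hp0 : (p0 : ℕ) = 0) (hp2 : (p2 : ℕ) = 2) (hp4 : (p4 : ℕ) = 4) (hp6 : (p6 : ℕ) = 6) :
    ((w p4 : Fin N) : ℕ) + ((w p6 : Fin N) : ℕ) +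
      ((if ((ι p0 : Fin (N + 2)) : ℕ) = 2 ∨ ((ι p2 : Fin (N + 2)) : ℕ) = 2 then 1 else 0) +
        (if ((ι p0 : Fin (N + 2)) : ℕ) = 1 ∨ ((ι p2 : Fin (N + 2)) : ℕ) = 1 ∨ ((ι p0 : Fin (N + 2)) : ℕ) = N + 1 ∨
            ((ι p2 : Fin (N + 2)) : ℕ) = N + 1 then 1 else 0)) = 2 := by
  classical
  -- the four slots of block `0` below the arm, and the cells they index
  obtain ⟨t0, ht0⟩ : ∃ s : Fin N, (s : ℕ) = 0 := ⟨⟨0, by omega⟩, rfl⟩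
  obtain ⟨t1, ht1⟩ : ∃ s : Fin N, (s : ℕ) = 1 := ⟨⟨1, by omega⟩, rfl⟩
  obtain ⟨t2, ht2⟩ : ∃ s : Fin N, (s : ℕ) = 2 := ⟨⟨2, by omega⟩, rfl⟩
  obtain ⟨t3, ht3⟩ : ∃ s : Fin N, (s : ℕ) = 3 := ⟨⟨3, by omega⟩, rfl⟩
  have hc0 : e.symm (0, t0) = p0 := Fin.ext (by rw [hesymm, hp0, ht0]; simp)
  have hc2 : e.symm (0, t1) = p2 := Fin.ext (by rw [hesymm, hp2, ht1]; simp)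
  have hc4 : e.symm (0, t2) = p4 := Fin.ext (by rw [hesymm, hp4, ht2]; simp)
  have hc6 : e.symm (0, t3) = p6 := Fin.ext (by rw [hesymm, hp6, ht3]; simp)
  -- letters versus `x`-letters and row letters
  have hι2 : ∀ q, ((ι q : Fin (N + 2)) : ℕ) = 2 ↔ ((x q : Fin N) : ℕ) = 2 := fun q => by
    rw [hxv]; have := (ι q).2; constructor <;> intro h <;> split_ifs at * <;> omega
  have hι1 : ∀ q, (((ι q : Fin (N + 2)) : ℕ) = 1 ∨ ((ι q : Fin (N + 2)) : ℕ) = N + 1) ↔ ((x q : Fin N) : ℕ) = 1 :=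
    fun q => by rw [hxv]; have := (ι q).2; constructor <;> intro h <;> split_ifs at * <;> omega
  have hw1 : ∀ q, ((w q : Fin N) : ℕ) = 1 ↔ (((ι q : Fin (N + 2)) : ℕ) = 1 ∨ ((ι q : Fin (N + 2)) : ℕ) = 2) :=
    fun q => by rw [hwv]; constructor <;> intro h <;> split_ifs at * <;> omega
  have hw3 : ∀ q, ((ι q : Fin (N + 2)) : ℕ) = N + 1 → ((w q : Fin N) : ℕ) = 3 := fun q hq => by
    rw [hwv]; split_ifs <;> omega
  -- the cells of block `0` carrying the `x`-letters `1` and `2`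
  obtain ⟨j1, hj1⟩ := hbx0.2 t1
  obtain ⟨j2, hj2⟩ := hbx0.2 t2
  have hj1v : ((x (e.symm (0, j1)) : Fin N) : ℕ) = 1 := by
    have h := congrArg Fin.val hj1; dsimp only at h; rw [ht1] at h; exact h
  have hj2v : ((x (e.symm (0, j2)) : Fin N) : ℕ) = 2 := by
    have h := congrArg Fin.val hj2; dsimp only at h; rw [ht2] at h; exact h
  have hj12 : (j1 : ℕ) ≠ (j2 : ℕ) := fun h => by
    have h' : j1 = j2 := Fin.ext h
    rw [h'] at hj1v; omega
  have hj2lt : (j2 : ℕ) < 4 := by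
    have hι := (hι2 _).2 hj2v
    have hw : ((w (e.symm (0, j2)) : Fin N) : ℕ) = 1 := (hw1 _).2 (Or.inr hι)
    by_contra hcon
    have h0 := harm (e.symm (0, j2)) (by rw [hesymm]; simp; omega)
    omega
  have hj1lt : (j1 : ℕ) < 4 := by
    have hι := (hι1 _).2 hj1v
    have hw : ((w (e.symm (0, j1)) : Fin N) : ℕ) ≠ 0 := by
      rcases hι with h | h
      · have := (hw1 _).2 (Or.inl h); omega
      · have := hw3 _ h; omega
    by_contra hcon
    exact hw (harm (e.symm (0, j1)) (by rw [hesymm]; simp; omega))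
  -- slot dichotomy from block-injectivity
  have slot : ∀ (s jv : Fin N) (v : ℕ), ((x (e.symm (0, jv)) : Fin N) : ℕ) = v →
      (((x (e.symm (0, s)) : Fin N) : ℕ) = v ∧ (jv : ℕ) = (s : ℕ)) ∨
        (((x (e.symm (0, s)) : Fin N) : ℕ) ≠ v ∧ (jv : ℕ) ≠ (s : ℕ)) := by
    intro s jv v hv
    by_cases h : jv = s
    · left; rw [← h]; exact ⟨hv, rfl⟩
    · right
      exact ⟨fun h' => h (hbx0.1 (Fin.ext (hv.trans h'.symm))), fun h' => h (Fin.ext h')⟩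
  have A0 := slot t0 j2 2 hj2v; have A2 := slot t1 j2 2 hj2v; have A4 := slot t2 j2 2 hj2v; have A6 := slot t3 j2 2 hj2v
  have B0 := slot t0 j1 1 hj1v; have B2 := slot t1 j1 1 hj1v; have B4 := slot t2 j1 1 hj1v; have B6 := slot t3 j1 1 hj1v
  rw [hc0, ht0] at A0 B0
  rw [hc2, ht1] at A2 B2
  rw [hc4, ht2] at A4 B4
  rw [hc6, ht3] at A6 B6
  -- the two domino cells of block `0`
  have hw4 : ((w p4 : Fin N) : ℕ) = (if (j2 : ℕ) = 2 then 1 else 0) + (if (j1 : ℕ) = 2 then 1 else 0) := by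
    have hd := hdom p4 (by omega) (by omega)
    have e2 := hι2 p4; have e1 := hι1 p4; have f1 := hw1 p4; have f3 := hw3 p4
    split_ifs <;> omega
  have hw6 : ((w p6 : Fin N) : ℕ) = (if (j2 : ℕ) = 3 then 1 else 0) + (if (j1 : ℕ) = 3 then 1 else 0) := by
    have hd := hdom p6 (by omega) (by omega)
    have e2 := hι2 p6; have e1 := hι1 p6; have f1 := hw1 p6; have f3 := hw3 p6
    split_ifs <;> omega
  -- the two column cells of block `0`
  have hcol2 : (if ((ι p0 : Fin (N + 2)) : ℕ) = 2 ∨ ((ι p2 : Fin (N + 2)) : ℕ) = 2 then 1 else 0) =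
      (if (j2 : ℕ) = 0 ∨ (j2 : ℕ) = 1 then 1 else 0 : ℕ) := by
    have e0 := hι2 p0; have e2 := hι2 p2
    split_ifs <;> omega
  have hcol1 : (if ((ι p0 : Fin (N + 2)) : ℕ) = 1 ∨ ((ι p2 : Fin (N + 2)) : ℕ) = 1 ∨ ((ι p0 : Fin (N + 2)) : ℕ) = N + 1 ∨
        ((ι p2 : Fin (N + 2)) : ℕ) = N + 1 then 1 else 0) = (if (j1 : ℕ) = 0 ∨ (j1 : ℕ) = 1 then 1 else 0 : ℕ) := by
    have e0 := hι1 p0; have e2 := hι1 p2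
    split_ifs <;> omega
  rw [hw4, hw6, hcol2, hcol1]
  split_ifs <;> omega

end Summit.MatrixMultiplication.MatrixMultiplication.Theorems.ObstructionCalculus

end
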